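import Mathlib

/-!
# Tier4/Line3/Witness/Coercive — coercivity of a positive definite hermitian `3×3` matrix
(seat t4-L2-p2, gen 0, for the R4 witness of LINE L3's `ThetaData` on t4-plan-3's word S12460; blind re-derivation
cell `pub-hodge-repro`, Tier 4, README §9–§10)

`exists_coercive_of_posDef`: for `M : Matrix (Fin 3) (Fin 3) ℂ` positive definite there is `λ > 0` with
`λ · Σ_i ‖v_i‖² ≤ re (v^* M v)` for every `v` — the minimum of the continuous form on the (compact) unit sphere
`Σ ‖v_i‖² = 1` is positive, and the form and the sum of squares both scale by `r²` under real scalars.  This is the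
lower bound behind the `decay` clause of the witness (`ThetaDataWitnessCf.lean`): the Gaussian of a definite place
`exp (−π |H_σ(v, v)|)` is at most `exp (−π λ_σ ‖v‖²)`.  Mathlib only.

Nothing here says anything about the status of the Hodge conjecture for CM abelian varieties, which is NOT proved
(HC_CM is NOT proved by anyone in this repository).
-/

set_option autoImplicit false

noncomputable section

open Matrix
open scoped ComplexOrder

namespace Summit.Ventures.HodgeRepro.Tier4.Line3

/-- The hermitian form of a matrix scales quadratically under real scalars. -/
theorem re_hermForm_real_smul (M : Matrix (Fin 3) (Fin 3) ℂ) (r : ℝ) (v : Fin 3 → ℂ) :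
    (star (((r : ℂ)) • v) ⬝ᵥ (M *ᵥ ((r : ℂ) • v))).re = r ^ 2 * (star v ⬝ᵥ (M *ᵥ v)).re := by
  rw [star_smul, Matrix.mulVec_smul, smul_dotProduct, dotProduct_smul, smul_eq_mul, smul_eq_mul,
    ← mul_assoc, Complex.star_def, Complex.conj_ofReal, ← Complex.ofReal_mul, ← sq,
    Complex.re_ofReal_mul]

/-- The sum of squares scales quadratically under real scalars. -/
theorem sum_sq_norm_real_smul (r : ℝ) (v : Fin 3 → ℂ) :
    ∑ i, ‖((r : ℂ) • v) i‖ ^ 2 = r ^ 2 * ∑ i, ‖v i‖ ^ 2 := by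
  rw [Finset.mul_sum]
  refine Finset.sum_congr rfl fun i _ => ?_
  rw [Pi.smul_apply, norm_smul, Complex.norm_real, mul_pow, Real.norm_eq_abs, sq_abs]

/-- **Coercivity of a positive definite hermitian matrix**: `re (v^* M v) ≥ λ ‖v‖²` for some `λ > 0`
(the minimum of the form on the unit sphere, which is compact). -/
theorem exists_coercive_of_posDef {M : Matrix (Fin 3) (Fin 3) ℂ} (hM : M.PosDef) :
    ∃ lam : ℝ, 0 < lam ∧ ∀ v : Fin 3 → ℂ, lam * ∑ i, ‖v i‖ ^ 2 ≤ (star v ⬝ᵥ (M *ᵥ v)).re := by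
  set f : (Fin 3 → ℂ) → ℝ := fun v => (star v ⬝ᵥ (M *ᵥ v)).re with hf_def
  set q : (Fin 3 → ℂ) → ℝ := fun v => ∑ i, ‖v i‖ ^ 2 with hq_def
  have hf : Continuous f := Complex.continuous_re.comp
    (continuous_star.dotProduct (continuous_const.matrix_mulVec continuous_id))
  have hq : Continuous q := by
    refine continuous_finsetSum _ fun i _ => ?_
    exact ((continuous_apply i).norm).pow 2
  set S : Set (Fin 3 → ℂ) := {v | q v = 1} with hS_def
  have hSc : IsClosed S := isClosed_eq hq continuous_const
  have hSb : Bornology.IsBounded S := by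
    rw [Metric.isBounded_iff_subset_closedBall (0 : Fin 3 → ℂ)]
    refine ⟨1, fun v hv => ?_⟩
    rw [mem_closedBall_zero_iff, pi_norm_le_iff_of_nonneg zero_le_one]
    intro i
    have h1 : ‖v i‖ ^ 2 ≤ q v := Finset.single_le_sum (fun j _ => sq_nonneg ‖v j‖) (Finset.mem_univ i)
    rw [show q v = 1 from hv] at h1
    exact (pow_le_one_iff_of_nonneg (norm_nonneg _) two_ne_zero).mp h1
  have hSne : S.Nonempty := ⟨Pi.single 0 1, by simp [hS_def, hq_def, Fin.sum_univ_succ]⟩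
  obtain ⟨v₀, hv₀S, hmin⟩ := (Metric.isCompact_of_isClosed_isBounded hSc hSb).exists_isMinOn hSne
    hf.continuousOn
  have hv₀ : v₀ ≠ 0 := by
    rintro rfl
    simp [hS_def, hq_def] at hv₀S
  refine ⟨f v₀, hM.re_dotProduct_pos hv₀, fun v => ?_⟩
  by_cases hv : v = 0
  · subst hv; simp [hf_def]
  · have hqv : 0 < q v := by
      have : ∃ i, v i ≠ 0 := by
        by_contra h
        push Not at h
        exact hv (funext h)
      obtain ⟨i, hi⟩ := this
      exact Finset.sum_pos' (fun j _ => sq_nonneg _) ⟨i, Finset.mem_univ i, by positivity⟩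
    set r : ℝ := Real.sqrt (q v) with hr_def
    have hr : 0 < r := Real.sqrt_pos.mpr hqv
    obtain ⟨u, hu_def⟩ : ∃ u : Fin 3 → ℂ, u = ((r⁻¹ : ℝ) : ℂ) • v := ⟨_, rfl⟩
    have huS : u ∈ S := by
      show q u = 1
      rw [hu_def, hq_def]
      simp only
      rw [sum_sq_norm_real_smul, inv_pow, hr_def, Real.sq_sqrt hqv.le]
      exact inv_mul_cancel₀ hqv.ne'
    have hvu : v = ((r : ℂ)) • u := by
      rw [hu_def, smul_smul, ← Complex.ofReal_mul, mul_inv_cancel₀ hr.ne', Complex.ofReal_one, one_smul]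
    have hfu : f v₀ ≤ f u := hmin huS
    have key : f v = r ^ 2 * f u := by
      have := re_hermForm_real_smul M r u
      rw [← hvu] at this
      exact this
    calc f v₀ * q v = f v₀ * r ^ 2 := by rw [hr_def, Real.sq_sqrt hqv.le]
      _ ≤ f u * r ^ 2 := by gcongr
      _ = f v := by rw [key, mul_comm]

end Summit.Ventures.HodgeRepro.Tier4.Line3
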